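import Mathlib
import HarnessLib
import Literature.Geometry.DiscreteGeometry.BondGraph
import Literature.Geometry.DiscreteGeometry.KissingPatterns
import Literature.Algebra.EuclideanLattices.FccBccLattices
import Summits.AtomisticToContinuum.Crystallization.Theorems.PricedLinkCensusSoftLayerPropagationStubMetricOcta
import Summits.AtomisticToContinuum.Crystallization.Theorems.PricedLinkCensusSoftLayerPropagationH1RSolve

/-!
# The sharp octahedron lemma (crux `SoftLayerPropagation`, line `Sketch`, stub `develop_H1R`)

Route `PricedLinkCensus`, crux `SoftLayerPropagation` (stmt-AtomisticToContinuum-14233), line `Sketch`.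
Helper file for the registered stub `develop_H1R`: the octahedron rigidity lemma of
`Theorems.metric_octahedron` with TWO tolerances — a coarse squared-edge window `[1, 1+α]` and a fine
bound `β` on the differences of the squared lengths of edges SHARING A VERTEX (in the bond setting
every vertex reads its four edges at its own scale to `1%`, so `β ≈ 0.02` while the common window has
`α ≈ 0.06`).  All nine polarised inner products of the three-diagonals proof are half-sums of two such
same-vertex differences, hence `≤ β`; with the quadratic solving lemma `Theorems.solve_sq` this gives
the centre identities `‖(a+c) − (b+d)‖² ≤ 4β²` (and cyclically), diagonals orthogonal to within `β`,
squared diagonals in `[2 − 2β − 4β², 2 + 2α + 2β + 2β²]`.  All `[folklore]`.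
-/

noncomputable section

namespace Summit.AtomisticToContinuum.Crystallization.Theorems

open Literature.Geometry.DiscreteGeometry

/-- Numerics of the first solving pass (`ν = 1`, `γ = β`, `β`'s `(β, β, 2β)`):
`D (1 − 3β² − 2β³) ≤ 6β² + 10β³ + 10β⁴` gives `D ≤ 7β²` for `β ≤ 1/20`. [folklore] -/
theorem octaSharp_pass_one {D β : ℝ} (hβ : 0 ≤ β) (hβ' : β ≤ 1 / 20) (hD : 0 ≤ D)
    (h : D * (1 ^ 2 * 1 ^ 2 * 1 ^ 2 - (1 ^ 2 + 1 ^ 2 + 1 ^ 2) * β ^ 2 - 2 * β ^ 3) ≤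
      6 * β ^ 2 + 10 * β ^ 3 + 10 * β ^ 4) : D ≤ 7 * β ^ 2 := by
  have hden : (99 : ℝ) / 100 ≤ 1 ^ 2 * 1 ^ 2 * 1 ^ 2 - (1 ^ 2 + 1 ^ 2 + 1 ^ 2) * β ^ 2 - 2 * β ^ 3 := by
    nlinarith [mul_nonneg hβ hβ, mul_nonneg (mul_nonneg hβ hβ) hβ]
  have hβ2 : 0 ≤ β ^ 2 := sq_nonneg β
  have e1 : 10 * β ^ 3 ≤ 1 / 2 * β ^ 2 := by nlinarith [mul_nonneg hβ2 hβ]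
  have e2 : 10 * β ^ 4 ≤ 1 / 40 * β ^ 2 := by nlinarith [mul_nonneg hβ2 hβ2, mul_nonneg hβ2 hβ]
  nlinarith [mul_le_mul_of_nonneg_left hden hD]

/-- Numerics of the second solving pass (`ν = 13/10`, `γ = β`):
`D (ν⁶ − 3β²ν² − 2β³) ≤ 6β²ν⁴ + 10β³ν² + 10β⁴` gives `D ≤ 4β²` for `β ≤ 1/20`. [folklore] -/
theorem octaSharp_pass_two {D β : ℝ} (hβ : 0 ≤ β) (hβ' : β ≤ 1 / 20) (hD : 0 ≤ D)
    (h : D * ((13 / 10) ^ 2 * (13 / 10) ^ 2 * (13 / 10) ^ 2 -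
        ((13 / 10) ^ 2 + (13 / 10) ^ 2 + (13 / 10) ^ 2) * β ^ 2 - 2 * β ^ 3) ≤
      6 * β ^ 2 * (13 / 10) ^ 4 + 10 * β ^ 3 * (13 / 10) ^ 2 + 10 * β ^ 4) : D ≤ 4 * β ^ 2 := by
  have hden : (481 : ℝ) / 100 ≤ (13 / 10) ^ 2 * (13 / 10) ^ 2 * (13 / 10) ^ 2 -
      ((13 / 10) ^ 2 + (13 / 10) ^ 2 + (13 / 10) ^ 2) * β ^ 2 - 2 * β ^ 3 := by
    nlinarith [mul_nonneg hβ hβ, mul_nonneg (mul_nonneg hβ hβ) hβ]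
  have hβ2 : 0 ≤ β ^ 2 := sq_nonneg β
  have e1 : 10 * β ^ 3 * (13 / 10 : ℝ) ^ 2 ≤ 169 / 200 * β ^ 2 := by nlinarith [mul_nonneg hβ2 hβ]
  have e2 : 10 * β ^ 4 ≤ 1 / 40 * β ^ 2 := by nlinarith [mul_nonneg hβ2 hβ2, mul_nonneg hβ2 hβ]
  nlinarith [mul_le_mul_of_nonneg_left hden hD]

set_option maxHeartbeats 800000 in
/-- **The sharp octahedron lemma (`metric_octahedron_sharp`).**  Diagonal pairs `(a,c)`, `(b,d)`, `(x,z)`;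
the twelve squared edges in `[1, 1+α]` (`0 ≤ α ≤ 1/10`), the three squared diagonals `≥ 1`, and the
twelve differences of squared edges sharing a vertex that enter the polarisation identities bounded by
`β` (`0 ≤ β ≤ 1/20`).  Then `‖(a+c)−(b+d)‖², ‖(b+d)−(x+z)‖², ‖(x+z)−(a+c)‖² ≤ 4β²`, the squared
diagonals lie in `[2 − 2β − 4β², 2 + 2α + 2β + 2β²]` (the eight further same-vertex bounds between an
equatorial and a polar edge at the four equatorial vertices sharpen the crude `2α` to `2β`), and `|⟪a−c, b−d⟫|, |⟪b−d, x−z⟫|, |⟪x−z, a−c⟫| ≤ β`.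
[folklore] -/
theorem metric_octahedron_sharp : ∀ α β : ℝ, 0 ≤ α → α ≤ 1 / 10 → 0 ≤ β → β ≤ 1 / 20 →
    ∀ (a c b d x z : EuclideanSpace ℝ (Fin 3)),
      1 ≤ ‖a - b‖ ^ 2 → ‖a - b‖ ^ 2 ≤ 1 + α → 1 ≤ ‖a - d‖ ^ 2 → ‖a - d‖ ^ 2 ≤ 1 + α →
      1 ≤ ‖c - b‖ ^ 2 → ‖c - b‖ ^ 2 ≤ 1 + α → 1 ≤ ‖c - d‖ ^ 2 → ‖c - d‖ ^ 2 ≤ 1 + α →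
      1 ≤ ‖b - x‖ ^ 2 → ‖b - x‖ ^ 2 ≤ 1 + α → 1 ≤ ‖b - z‖ ^ 2 → ‖b - z‖ ^ 2 ≤ 1 + α →
      1 ≤ ‖d - x‖ ^ 2 → ‖d - x‖ ^ 2 ≤ 1 + α → 1 ≤ ‖d - z‖ ^ 2 → ‖d - z‖ ^ 2 ≤ 1 + α →
      1 ≤ ‖x - a‖ ^ 2 → ‖x - a‖ ^ 2 ≤ 1 + α → 1 ≤ ‖x - c‖ ^ 2 → ‖x - c‖ ^ 2 ≤ 1 + α →
      1 ≤ ‖z - a‖ ^ 2 → ‖z - a‖ ^ 2 ≤ 1 + α → 1 ≤ ‖z - c‖ ^ 2 → ‖z - c‖ ^ 2 ≤ 1 + α →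
      1 ≤ ‖a - c‖ ^ 2 → 1 ≤ ‖b - d‖ ^ 2 → 1 ≤ ‖x - z‖ ^ 2 →
      |‖a - b‖ ^ 2 - ‖a - d‖ ^ 2| ≤ β → |‖c - b‖ ^ 2 - ‖c - d‖ ^ 2| ≤ β →
      |‖a - b‖ ^ 2 - ‖c - b‖ ^ 2| ≤ β → |‖a - d‖ ^ 2 - ‖c - d‖ ^ 2| ≤ β →
      |‖b - x‖ ^ 2 - ‖b - z‖ ^ 2| ≤ β → |‖d - x‖ ^ 2 - ‖d - z‖ ^ 2| ≤ β →
      |‖b - x‖ ^ 2 - ‖d - x‖ ^ 2| ≤ β → |‖b - z‖ ^ 2 - ‖d - z‖ ^ 2| ≤ β →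
      |‖x - a‖ ^ 2 - ‖x - c‖ ^ 2| ≤ β → |‖z - a‖ ^ 2 - ‖z - c‖ ^ 2| ≤ β →
      |‖x - a‖ ^ 2 - ‖z - a‖ ^ 2| ≤ β → |‖x - c‖ ^ 2 - ‖z - c‖ ^ 2| ≤ β →
      |‖a - b‖ ^ 2 - ‖b - x‖ ^ 2| ≤ β → |‖a - d‖ ^ 2 - ‖d - x‖ ^ 2| ≤ β →
      |‖c - b‖ ^ 2 - ‖b - z‖ ^ 2| ≤ β → |‖c - d‖ ^ 2 - ‖d - z‖ ^ 2| ≤ β →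
      |‖a - b‖ ^ 2 - ‖x - a‖ ^ 2| ≤ β → |‖a - d‖ ^ 2 - ‖z - a‖ ^ 2| ≤ β →
      |‖c - b‖ ^ 2 - ‖x - c‖ ^ 2| ≤ β → |‖c - d‖ ^ 2 - ‖z - c‖ ^ 2| ≤ β →
      ‖a + c - (b + d)‖ ^ 2 ≤ 4 * β ^ 2 ∧ ‖b + d - (x + z)‖ ^ 2 ≤ 4 * β ^ 2 ∧
        ‖x + z - (a + c)‖ ^ 2 ≤ 4 * β ^ 2 ∧
      (2 - 2 * β - 4 * β ^ 2 ≤ ‖a - c‖ ^ 2 ∧ ‖a - c‖ ^ 2 ≤ 2 + 2 * α + 2 * β + 2 * β ^ 2) ∧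
      (2 - 2 * β - 4 * β ^ 2 ≤ ‖b - d‖ ^ 2 ∧ ‖b - d‖ ^ 2 ≤ 2 + 2 * α + 2 * β + 2 * β ^ 2) ∧
      (2 - 2 * β - 4 * β ^ 2 ≤ ‖x - z‖ ^ 2 ∧ ‖x - z‖ ^ 2 ≤ 2 + 2 * α + 2 * β + 2 * β ^ 2) ∧
      |inner ℝ (a - c) (b - d)| ≤ β ∧ |inner ℝ (b - d) (x - z)| ≤ β ∧ |inner ℝ (x - z) (a - c)| ≤ β := by
  intro α β hα hα' hβ hβ' a c b d x z hab hab' had had' hcb hcb' hcd hcd' hbx hbx' hbz hbz' hdx hdx' hdz hdz'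
    hxa hxa' hxc hxc' hza hza' hzc hzc' hac hbd hxz qa1 qc1 qb1 qd1 qb2 qd2 qx2 qz2 qx3 qz3 qa3 qc3
    rb1 rd1 rb2 rd2 ra1 ra2 rc1 rc2
  -- the three diagonal pairs: identities, and the cyclic relation for the third inner products
  obtain ⟨i12a, i12b, i12c, i12d⟩ := diag_pair_identities a c b d
  obtain ⟨i23a, i23b, i23c, i23d⟩ := diag_pair_identities b d x z
  obtain ⟨i31a, i31b, i31c, i31d⟩ := diag_pair_identities x z a c
  have c12 := diag_offsets_inner a c b d x z (x - z)
  have c23 := diag_offsets_inner b d x z a c (a - c)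
  have c31 := diag_offsets_inner x z a c b d (b - d)
  have e31 : inner ℝ (x - z) (a - c) = inner ℝ (a - c) (x - z) := real_inner_comm _ _
  -- unpack the same-vertex bounds
  have Qa1 := abs_le.1 qa1; have Qc1 := abs_le.1 qc1; have Qb1 := abs_le.1 qb1; have Qd1 := abs_le.1 qd1
  have Qb2 := abs_le.1 qb2; have Qd2 := abs_le.1 qd2; have Qx2 := abs_le.1 qx2; have Qz2 := abs_le.1 qz2
  have Qx3 := abs_le.1 qx3; have Qz3 := abs_le.1 qz3; have Qa3 := abs_le.1 qa3; have Qc3 := abs_le.1 qc3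
  have Rb1 := abs_le.1 rb1; have Rd1 := abs_le.1 rd1; have Rb2 := abs_le.1 rb2; have Rd2 := abs_le.1 rd2
  have Ra1 := abs_le.1 ra1; have Ra2 := abs_le.1 ra2; have Rc1 := abs_le.1 rc1; have Rc2 := abs_le.1 rc2
  -- names (made opaque)
  generalize hn₁ : a - c = n₁ at *
  generalize hn₂ : b - d = n₂ at *
  generalize hn₃ : x - z = n₃ at *
  generalize hΔ₁₂ : a + c - (b + d) = Δ₁₂ at *
  generalize hΔ₂₃ : b + d - (x + z) = Δ₂₃ at *
  generalize hΔ₃₁ : x + z - (a + c) = Δ₃₁ at *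
  -- the nine small inner products: half-sums of two same-vertex differences
  have o12 : |inner ℝ n₁ n₂| ≤ β :=
    abs_le.2 ⟨by linarith only [i12c, Qa1.2, Qc1.1], by linarith only [i12c, Qa1.1, Qc1.2]⟩
  have o23 : |inner ℝ n₂ n₃| ≤ β :=
    abs_le.2 ⟨by linarith only [i23c, Qb2.2, Qd2.1], by linarith only [i23c, Qb2.1, Qd2.2]⟩
  have o31 : |inner ℝ n₃ n₁| ≤ β :=
    abs_le.2 ⟨by linarith only [i31c, Qx3.2, Qz3.1], by linarith only [i31c, Qx3.1, Qz3.2]⟩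
  have o13 : |inner ℝ n₁ n₃| ≤ β := by rwa [e31] at o31
  have p12a : |inner ℝ Δ₁₂ n₁| ≤ β :=
    abs_le.2 ⟨by linarith only [i12a, Qb1.1, Qd1.1], by linarith only [i12a, Qb1.2, Qd1.2]⟩
  have p12b : |inner ℝ Δ₁₂ n₂| ≤ β :=
    abs_le.2 ⟨by linarith only [i12b, Qa1.2, Qc1.2], by linarith only [i12b, Qa1.1, Qc1.1]⟩
  have p23a : |inner ℝ Δ₂₃ n₂| ≤ β :=
    abs_le.2 ⟨by linarith only [i23a, Qx2.1, Qz2.1], by linarith only [i23a, Qx2.2, Qz2.2]⟩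
  have p23b : |inner ℝ Δ₂₃ n₃| ≤ β :=
    abs_le.2 ⟨by linarith only [i23b, Qb2.2, Qd2.2], by linarith only [i23b, Qb2.1, Qd2.1]⟩
  have p31a : |inner ℝ Δ₃₁ n₃| ≤ β :=
    abs_le.2 ⟨by linarith only [i31a, Qa3.1, Qc3.1], by linarith only [i31a, Qa3.2, Qc3.2]⟩
  have p31b : |inner ℝ Δ₃₁ n₁| ≤ β :=
    abs_le.2 ⟨by linarith only [i31b, Qx3.2, Qz3.2], by linarith only [i31b, Qx3.1, Qz3.1]⟩
  -- the third inner products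
  have p12c : |inner ℝ Δ₁₂ n₃| ≤ 2 * β := by
    have h1 := abs_le.1 p23b; have h2 := abs_le.1 p31a
    rw [c12]; exact abs_le.2 ⟨by linarith only [h1, h2], by linarith only [h1, h2]⟩
  have p23c : |inner ℝ Δ₂₃ n₁| ≤ 2 * β := by
    have h1 := abs_le.1 p12a; have h2 := abs_le.1 p31b
    rw [c23]; exact abs_le.2 ⟨by linarith only [h1, h2], by linarith only [h1, h2]⟩
  have p31c : |inner ℝ Δ₃₁ n₂| ≤ 2 * β := by
    have h1 := abs_le.1 p12b; have h2 := abs_le.1 p23a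
    rw [c31]; exact abs_le.2 ⟨by linarith only [h1, h2], by linarith only [h1, h2]⟩
  -- the diagonals have length `≥ 1`
  have l₁ : 1 ≤ ‖n₁‖ := (pow_le_pow_iff_left₀ zero_le_one (norm_nonneg _) two_ne_zero).1 (by simpa using hac)
  have l₂ : 1 ≤ ‖n₂‖ := (pow_le_pow_iff_left₀ zero_le_one (norm_nonneg _) two_ne_zero).1 (by simpa using hbd)
  have l₃ : 1 ≤ ‖n₃‖ := (pow_le_pow_iff_left₀ zero_le_one (norm_nonneg _) two_ne_zero).1 (by simpa using hxz)
  -- first pass: `ν = 1`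
  have hβ2 : 0 ≤ 2 * β := by linarith only [hβ]
  have s12 := solve_sq one_pos one_pos one_pos hβ hβ hβ hβ2 Δ₁₂ n₁ n₂ n₃ l₁ l₂ l₃ o12 o13 o23 p12a p12b p12c
  have s23 := solve_sq one_pos one_pos one_pos hβ hβ2 hβ hβ Δ₂₃ n₁ n₂ n₃ l₁ l₂ l₃ o12 o13 o23 p23c p23a p23b
  have s31 := solve_sq one_pos one_pos one_pos hβ hβ hβ2 hβ Δ₃₁ n₁ n₂ n₃ l₁ l₂ l₃ o12 o13 o23 p31b p31c p31a
  have hΔ0₁ : 0 ≤ ‖Δ₁₂‖ ^ 2 := sq_nonneg _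
  have hΔ0₂ : 0 ≤ ‖Δ₂₃‖ ^ 2 := sq_nonneg _
  have hΔ0₃ : 0 ≤ ‖Δ₃₁‖ ^ 2 := sq_nonneg _
  have D12 : ‖Δ₁₂‖ ^ 2 ≤ 7 * β ^ 2 := octaSharp_pass_one hβ hβ' hΔ0₁ (s12.trans_eq (by ring))
  have D23 : ‖Δ₂₃‖ ^ 2 ≤ 7 * β ^ 2 := octaSharp_pass_one hβ hβ' hΔ0₂ (s23.trans_eq (by ring))
  have D31 : ‖Δ₃₁‖ ^ 2 ≤ 7 * β ^ 2 := octaSharp_pass_one hβ hβ' hΔ0₃ (s31.trans_eq (by ring))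
  -- second pass: now `‖nₖ‖² ≥ 2 − 2α − 7β² ≥ (13/10)²`
  have hββ : β ^ 2 ≤ 1 / 20 * β := by rw [sq]; exact mul_le_mul_of_nonneg_right hβ' hβ
  have hβsq : 0 ≤ β ^ 2 := sq_nonneg β
  have q₁ : (13 / 10 : ℝ) ^ 2 ≤ ‖n₁‖ ^ 2 := by
    linarith only [i12d, i31d, i23d, D12, D31, hΔ0₂, hab, had, hcb, hcd, hxa, hxc, hza, hzc, hbx', hbz', hdx',
      hdz', hββ, hβ', hα']
  have q₂ : (13 / 10 : ℝ) ^ 2 ≤ ‖n₂‖ ^ 2 := by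
    linarith only [i12d, i23d, i31d, D12, D23, hΔ0₃, hab, had, hcb, hcd, hbx, hbz, hdx, hdz, hxa', hxc', hza',
      hzc', hββ, hβ', hα']
  have q₃ : (13 / 10 : ℝ) ^ 2 ≤ ‖n₃‖ ^ 2 := by
    linarith only [i23d, i31d, i12d, D23, D31, hΔ0₁, hbx, hbz, hdx, hdz, hxa, hxc, hza, hzc, hab', had', hcb',
      hcd', hββ, hβ', hα']
  have h13 : (0 : ℝ) ≤ 13 / 10 := by norm_num
  have l₁' : (13 : ℝ) / 10 ≤ ‖n₁‖ := (pow_le_pow_iff_left₀ h13 (norm_nonneg _) two_ne_zero).1 q₁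
  have l₂' : (13 : ℝ) / 10 ≤ ‖n₂‖ := (pow_le_pow_iff_left₀ h13 (norm_nonneg _) two_ne_zero).1 q₂
  have l₃' : (13 : ℝ) / 10 ≤ ‖n₃‖ := (pow_le_pow_iff_left₀ h13 (norm_nonneg _) two_ne_zero).1 q₃
  have h13p : (0 : ℝ) < 13 / 10 := by norm_num
  have t12 := solve_sq h13p h13p h13p hβ hβ hβ hβ2 Δ₁₂ n₁ n₂ n₃ l₁' l₂' l₃' o12 o13 o23 p12a p12b p12c
  have t23 := solve_sq h13p h13p h13p hβ hβ2 hβ hβ Δ₂₃ n₁ n₂ n₃ l₁' l₂' l₃' o12 o13 o23 p23c p23a p23b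
  have t31 := solve_sq h13p h13p h13p hβ hβ hβ2 hβ Δ₃₁ n₁ n₂ n₃ l₁' l₂' l₃' o12 o13 o23 p31b p31c p31a
  have E12 : ‖Δ₁₂‖ ^ 2 ≤ 4 * β ^ 2 := octaSharp_pass_two hβ hβ' hΔ0₁ (t12.trans_eq (by ring))
  have E23 : ‖Δ₂₃‖ ^ 2 ≤ 4 * β ^ 2 := octaSharp_pass_two hβ hβ' hΔ0₂ (t23.trans_eq (by ring))
  have E31 : ‖Δ₃₁‖ ^ 2 ≤ 4 * β ^ 2 := octaSharp_pass_two hβ hβ' hΔ0₃ (t31.trans_eq (by ring))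
  -- the diagonals: `2‖n₁‖² = E₁₂ + E₃₁ − E₂₃ − ‖Δ₁₂‖² − ‖Δ₃₁‖² + ‖Δ₂₃‖²` with `E₁₂ − E₂₃` a sum of four
  -- same-vertex differences, `E₃₁ ∈ [4, 4 + 4α]`; and cyclically
  refine ⟨E12, E23, E31, ⟨?_, ?_⟩, ⟨?_, ?_⟩, ⟨?_, ?_⟩, o12, o23, o31⟩
  · linarith only [i12d, i31d, i23d, E12, E31, hΔ0₂, Rb1.1, Rd1.1, Rb2.1, Rd2.1, hxa, hxc, hza, hzc]
  · linarith only [i12d, i31d, i23d, E23, hΔ0₁, hΔ0₃, Rb1.2, Rd1.2, Rb2.2, Rd2.2, hxa', hxc', hza', hzc']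
  · linarith only [i12d, i23d, i31d, E12, E23, hΔ0₃, Ra1.1, Ra2.1, Rc1.1, Rc2.1, hbx, hbz, hdx, hdz]
  · linarith only [i12d, i23d, i31d, E31, hΔ0₁, hΔ0₂, Ra1.2, Ra2.2, Rc1.2, Rc2.2, hbx', hbz', hdx', hdz']
  · linarith only [i23d, i31d, i12d, E23, E31, hΔ0₁, Rb1.2, Rd1.2, Rb2.2, Rd2.2, hxa, hxc, hza, hzc]
  · linarith only [i23d, i31d, i12d, E12, hΔ0₂, hΔ0₃, Rb1.1, Rd1.1, Rb2.1, Rd2.1, hxa', hxc', hza', hzc']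

end Summit.AtomisticToContinuum.Crystallization.Theorems

end
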